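import Summits.ResolutionOfSingularities.ResolutionOfSingularities.Theorems.RisoStrataRtdLocalPad
import Summits.ResolutionOfSingularities.ResolutionOfSingularities.Theorems.RisoStrataRtdUpperSemicontinuousEdim

/-!
# Crux `RisoCentresResolve` (stmt-ResolutionOfSingularities-18546), line `Sketch` — stub `rtd_product_pad`

The PRODUCT move on the route's inline riso-triviality-dimension clauses over
`H := k⟦t^ℚ⟧ = HahnSeries ℚ k` with valuation `v := orderTop`.

For a family of arc coordinates `c : ι → J → H` the three inline clauses are
(1) rv-straightening `∀ a ≠ b, ∃ j, ∀ i, v (c a j - c b j) < v ((φ a i - φ b i) - (c a i - c b i))`,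
(2) positivity `0 < v (φ a i)`, and (3) invariance of the straightened family `φ` under translation
by positive vectors of the `H`-span of `C '' W`, for some `W ≤ k^J` of rank `≥ r`.

Adjoining one independent coordinate — the arcs of the product are the pairs `(a, σ)` with `σ`
any Hahn series of positive order, and the new coordinate of `(a, σ)` is `σ` itself — raises the
rank by one: take `W' := {v : k^(J ⊕ 1) | v ∘ inl ∈ W} = W × k` and `φ' (a, σ) := (φ a, σ)`.
* rank: `W × 0 < W × k` strictly (the vector `(0, 1)` separates them), so
  `finrank W' ≥ finrank W + 1 ≥ r + 1`.
* (1): for `(a, σ) ≠ (b, τ)` with `a ≠ b` use the old witness `j₀ : J`; the error term on the new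
  coordinate is `(σ - τ) - (σ - τ) = 0`. If `a = b` then `σ ≠ τ`; use the new coordinate, where
  `v (σ - τ) < ⊤` and every error term vanishes.
* (2): old components from (2), the new component is `σ`, positive by construction.
* (3): restricting a positive translation vector `w'` in the `H`-span of `C '' W'` to the old
  block gives a positive vector in the `H`-span of `C '' W` (apply the `H`-linear restriction map
  to the span); translate `a` by it using (3) and replace `σ` by `σ + w' (inr ⋆)`, still positive.

Mathlib only (plus the tree helper `lt_orderTop_add`); no definitions, no named facts.
-/

set_option linter.dupNamespace false -- mandated namespace of this single-conjunct summit

namespace Summit.ResolutionOfSingularities.ResolutionOfSingularities.Theorems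

/-- **PRODUCT PAD** (stub `rtd_product_pad` of crux `RisoCentresResolve`, line `Sketch`): a typed
straightener of rank `≥ r` for the arc coordinates `c : ι → J → k⟦t^ℚ⟧` yields one of rank `≥ r + 1`
for the product family indexed by `ι × {σ // 0 < v σ}` with coordinates `(c a, σ) : J ⊕ Unit → k⟦t^ℚ⟧`,
namely `W' := W × k` and `φ' (a, σ) := (φ a, σ)`. -/
theorem rtd_product_pad : ∀ {k : Type} [Field k] {ι J : Type} [Fintype J] (c : ι → J → HahnSeries ℚ k) (r : ℕ), (∃ W : Submodule k (J → k), r ≤ Module.finrank k W ∧ ∃ φ : ι → J → HahnSeries ℚ k, (∀ a b, a ≠ b → ∃ j, ∀ i, (c a j - c b j).orderTop < ((φ a i - φ b i) - (c a i - c b i)).orderTop) ∧ (∀ a i, 0 < (φ a i).orderTop) ∧ (∀ a (w : J → HahnSeries ℚ k), (∀ i, 0 < (w i).orderTop) → w ∈ Submodule.span (HahnSeries ℚ k) ((fun u : J → k => fun i => HahnSeries.C (u i)) '' (W : Set (J → k))) → ∃ b, φ b = φ a + w)) → ∃ W : Submodule k (J ⊕ Unit → k), r + 1 ≤ Module.finrank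 k W ∧ ∃ φ : ι × {s : HahnSeries ℚ k // 0 < s.orderTop} → J ⊕ Unit → HahnSeries ℚ k, (∀ a b : ι × {s : HahnSeries ℚ k // 0 < s.orderTop}, a ≠ b → ∃ j, ∀ i, (Sum.elim (c a.1) (fun _ : Unit => a.2.1) j - Sum.elim (c b.1) (fun _ : Unit => b.2.1) j).orderTop < ((φ a i - φ b i) - (Sum.elim (c a.1) (fun _ : Unit => a.2.1) i - Sum.elim (c b.1) (fun _ : Unit => b.2.1) i)).orderTop) ∧ (∀ a i, 0 < (φ a i).orderTop) ∧ (∀ a (w : J ⊕ Unit → HahnSeries ℚ k), (∀ i, 0 < (w i).orderTop) → w ∈ Submodule.span (HahnSeries ℚ k) ((fun u : J ⊕ Unit → k => fun i => HahnSeries.C (u i)) '' (W : Set (J ⊕ Unit → k))) → ∃ b, φ b = φ a + w) := by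
  intro k _ ι J _ c r h
  obtain ⟨W, hW, φ, h1, h2, h3⟩ := h
  -- the `k`-linear padding `u ↦ (u, 0)` of coefficient vectors
  let E : (J → k) →ₗ[k] (J ⊕ Unit → k) :=
    { toFun := fun u => Sum.elim u 0
      map_add' := fun u u' => by
        funext i
        cases i <;> simp
      map_smul' := fun t u => by
        funext i
        cases i <;> simp }
  have hEapp : ∀ u, E u = Sum.elim u 0 := fun u => rfl
  have hE : Function.Injective E := fun u u' huu' => by
    funext j
    exact congrFun huu' (Sum.inl j)
  -- the `k`-linear restriction `v ↦ v ∘ inl` of coefficient vectors to the old block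
  let L : (J ⊕ Unit → k) →ₗ[k] (J → k) := LinearMap.funLeft k k Sum.inl
  have hLE : ∀ u, L (E u) = u := fun u => by
    funext j
    rfl
  -- the `H`-linear restriction `x ↦ x ∘ inl` of translation vectors to the old block
  let LH : (J ⊕ Unit → HahnSeries ℚ k) →ₗ[HahnSeries ℚ k] (J → HahnSeries ℚ k) :=
    LinearMap.funLeft (HahnSeries ℚ k) (HahnSeries ℚ k) Sum.inl
  refine ⟨W.comap L, ?_, fun a => Sum.elim (φ a.1) (fun _ => a.2.1), ?_, ?_, ?_⟩
  · -- rank: `W × 0 = W.map E < W.comap L = W × k`, witnessed by the vector `(0, 1)`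
    have hle : W.map E ≤ W.comap L := by
      intro v hv
      obtain ⟨u, hu, rfl⟩ := Submodule.mem_map.mp hv
      rw [Submodule.mem_comap, hLE]
      exact hu
    have h0 : L (Sum.elim (0 : J → k) fun _ : Unit => (1 : k)) = 0 := by
      funext j
      rfl
    have hlt : W.map E < W.comap L := by
      refine SetLike.lt_iff_le_and_exists.mpr
        ⟨hle, Sum.elim (0 : J → k) fun _ : Unit => (1 : k), ?_, ?_⟩
      · rw [Submodule.mem_comap, h0]
        exact W.zero_mem
      · intro hmem
        obtain ⟨u, -, hu⟩ := Submodule.mem_map.mp hmem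
        have h01 := congrFun hu (Sum.inr ())
        rw [hEapp] at h01
        simp at h01
    have hfin := Submodule.finrank_lt_finrank_of_lt hlt
    rw [← (Submodule.equivMapOfInjective E hE W).finrank_eq] at hfin
    omega
  · -- clause (1): rv-straightening
    rintro ⟨a, σ, hσ⟩ ⟨b, τ, hτ⟩ hab
    by_cases heq : a = b
    · subst heq
      have hστ : σ - τ ≠ 0 := by
        intro h0
        exact hab (Prod.ext rfl (Subtype.ext (sub_eq_zero.mp h0)))
      refine ⟨Sum.inr (), ?_⟩
      rintro (i | i)
      · simp only [Sum.elim_inr, Sum.elim_inl, sub_self, HahnSeries.orderTop_zero]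
        exact HahnSeries.orderTop_lt_top.mpr hστ
      · simp only [Sum.elim_inr, sub_self, HahnSeries.orderTop_zero]
        exact HahnSeries.orderTop_lt_top.mpr hστ
    · obtain ⟨j₀, hj₀⟩ := h1 a b heq
      refine ⟨Sum.inl j₀, ?_⟩
      rintro (i | i)
      · simp only [Sum.elim_inl]
        exact hj₀ i
      · simp only [Sum.elim_inl, Sum.elim_inr, sub_self, HahnSeries.orderTop_zero]
        exact (hj₀ j₀).trans_le le_top
  · -- clause (2): positivity (the new component is `σ`, positive by construction)
    rintro ⟨a, σ, hσ⟩ (i | i)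
    · exact h2 a i
    · exact hσ
  · -- clause (3): translation invariance
    rintro ⟨a, σ, hσ⟩ w' hw' hmem
    have hw : LH w' ∈ Submodule.span (HahnSeries ℚ k)
        ((fun u : J → k => fun i => HahnSeries.C (u i)) '' (W : Set (J → k))) := by
      have h' := Submodule.mem_map_of_mem (f := LH) hmem
      rw [Submodule.map_span] at h'
      refine Submodule.span_mono ?_ h'
      rintro _ ⟨_, ⟨v, hv, rfl⟩, rfl⟩
      exact ⟨L v, hv, rfl⟩
    obtain ⟨b, hb⟩ := h3 a (LH w') (fun j => hw' (Sum.inl j)) hw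
    refine ⟨(b, ⟨σ + w' (Sum.inr ()), lt_orderTop_add hσ (hw' _)⟩), ?_⟩
    funext i
    cases i with
    | inl j =>
      simp only [Sum.elim_inl, Pi.add_apply, hb]
      rfl
    | inr u =>
      simp only [Sum.elim_inr, Pi.add_apply]

end Summit.ResolutionOfSingularities.ResolutionOfSingularities.Theorems
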